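import Summits.SmoothPoincare4.SmoothPoincare4.Theorems.ConvexBisectionAcyclicBisectionExistsPageRotationField
import HarnessLib

/-!
# The radial straightening field of the Lefschetz base: extended pages flow into flat pages
(wave 4, brick ST2 (field part) of node T3c-2 `node_seam_transport` of stub
`stub_steinRealisation` = NF6, line `modp-braid-orbits` r11, crux
`ConvexBisection.AcyclicBisectionExists`, item stmt-SmoothPoincare4-10508; registered sub-goal
`helper_strField_spec`)

The boundary `∂ Base g = {rho g = 1/4}` of the base (`rho g = ‖w‖² + eta ‖x‖²`,
`w = y² − x^{2g+1} − 1`, `LefschetzBaseModel.lean`) is an open book away from the binding `w = 0`: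
the EXTENDED PAGE of direction `c` is `{rho = 1/4, w ∈ ℝ_{>0} · c}`; its FLAT part `‖x‖² < 4`
(where `eta = 0`, `‖w‖ = 1/2`) is the page `page g c = {‖x‖² < 4, w = c/2}` of
`LefschetzBasePages.lean`, and over `‖x‖² ≥ 4` it bends down to the binding (`‖w‖ ↓ 0`).  The seam
diffeomorphism of a fibred model carries page curves into extended pages (node T3c-2); to bring
them back into flat pages one flows along a vector field which is tangent to `{rho = const}`,
preserves the direction of `w` and DECREASES `‖x‖²` — the field of this file, complementary to the
page-rotation field `rotField g` of `…PageRotationField.lean` (which moves `arg w` and fixes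
`‖x‖²` near the rim):

* §1 `strMu q = eta'(‖x‖²) · ‖x‖² ≥ 0`, the CORE FIELD
  `strCore g q = (−‖w‖² x, (strMu · w + Φₓ ‖w‖² x) / Φ_y)` (so that `dx = −‖w‖² x` and
  `dw = strMu · w`: then `d rho = 2 strMu ‖w‖² − eta' · 2 ‖w‖² ‖x‖² = 0`), the GAIN
  `strGain g q = cutA (rho q) · cutB ‖x‖²` (cut-offs of the rotation-field file: supported in
  `{rho ≤ 2/5} ∩ {‖x‖² ≥ 3}`, where `y ≠ 0` so that the core field is smooth), and the
  STRAIGHTENING FIELD `strField g L = (L · strGain) • strCore` with a speed `L`;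
* §2 algebra: `cx_strField` (**`dx(V) = −L · strGain · ‖w‖² · x`**), `fderiv_w_strField`
  (**`dw(V) = (L · strGain · strMu) · w`**, a REAL multiple of `w`: the flow preserves `arg w` and
  the binding), `fderiv_rho_strField` (**`d rho(V) = 0`**), vanishing on `{rho ≥ 2/5}`,
  `{‖x‖² ≤ 3}`, `{w = 0}`;
* §3 smoothness `contDiff_strField` and the registered package `helper_strField_spec`.

The sequel `…SeamStraightenFlow.lean` integrates the field.  Everything is proved; no named facts,
no `sorry`.  References: R. İ. Baykur, *Kähler decomposition of 4-manifolds*, AGT 6 (2006), proof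
of Thm. 5.1 [Baykur2006]; R. E. Gompf, A. I. Stipsicz, *4-Manifolds and Kirby Calculus* (1999),
§8.2.
-/

noncomputable section

set_option linter.dupNamespace false

open scoped Manifold ContDiff Topology ComplexConjugate
open Set Function Metric
open Literature.Topology.FourManifolds Literature.Topology.FourManifolds.LefschetzBase

namespace Summit.SmoothPoincare4.SmoothPoincare4.Theorems.AcyclicBisectionExists.ModpBraidOrbits

variable {g : ℕ} {L : ℝ}

/-! ## §1 The core field, the gain and the straightening field -/

/-- The real factor `strMu q = eta'(‖x‖²) · ‖x‖²` by which the core field dilates `w`. [folklore] -/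
def strMu (q : EuclideanSpace ℝ (Fin 4)) : ℝ := deriv eta (‖cx q‖ ^ 2) * ‖cx q‖ ^ 2

/-- **The core straightening field** `(−‖w‖² x, (strMu · w + Φₓ · ‖w‖² x) / Φ_y)`: it moves `x`
radially inwards (`dx = −‖w‖² x`) and dilates `w` by the real factor `strMu` (`dw = strMu · w`),
the two rates being balanced so that `rho = ‖w‖² + eta ‖x‖²` is preserved; smooth where `y ≠ 0`.
[folklore] -/
def strCore (g : ℕ) (q : EuclideanSpace ℝ (Fin 4)) : EuclideanSpace ℝ (Fin 4) :=
  mk (-(((‖w g q‖ ^ 2 : ℝ) : ℂ) * cx q))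
    ((((strMu q : ℝ) : ℂ) * w g q + dPhiX g q * (((‖w g q‖ ^ 2 : ℝ) : ℂ) * cx q)) / dPhiY q)

/-- **The gain** `cutA (rho q) · cutB ‖x‖²`: `1` on `{rho ≤ 3/10} ∩ {‖x‖² ≥ 7/2}`, `0` off
`{rho < 2/5} ∩ {‖x‖² > 3}` (where `y ≠ 0`, `cy_ne_zero_of_rho_lt_half`). [folklore] -/
def strGain (g : ℕ) (q : EuclideanSpace ℝ (Fin 4)) : ℝ := cutA (rho g q) * cutB (‖cx q‖ ^ 2)

/-- **The straightening field at speed `L`**: `(L · strGain) • strCore`. [folklore] -/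
def strField (g : ℕ) (L : ℝ) (q : EuclideanSpace ℝ (Fin 4)) : EuclideanSpace ℝ (Fin 4) :=
  (L * strGain g q) • strCore g q

/-- `strMu ≥ 0` (the cut-off `eta` is monotone, so `eta' ≥ 0`). [folklore] -/
theorem strMu_nonneg (q : EuclideanSpace ℝ (Fin 4)) : 0 ≤ strMu q :=
  mul_nonneg eta_monotone.deriv_nonneg (sq_nonneg _)

/-- The gain is non-negative. [folklore] -/
theorem strGain_nonneg (q : EuclideanSpace ℝ (Fin 4)) : 0 ≤ strGain g q :=
  mul_nonneg (Real.smoothTransition.nonneg _) (Real.smoothTransition.nonneg _)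

/-- The gain is at most `1`. [folklore] -/
theorem strGain_le_one (q : EuclideanSpace ℝ (Fin 4)) : strGain g q ≤ 1 := by
  unfold strGain
  have h1 := Real.smoothTransition.le_one (4 - 10 * rho g q)
  have h2 := Real.smoothTransition.le_one (2 * (‖cx q‖ ^ 2 - 3))
  have h3 := Real.smoothTransition.nonneg (2 * (‖cx q‖ ^ 2 - 3))
  calc cutA (rho g q) * cutB (‖cx q‖ ^ 2) ≤ 1 * 1 := by
        unfold cutA cutB; exact mul_le_mul h1 h2 h3 zero_le_one
    _ = 1 := one_mul 1

/-- The gain is `1` on `{rho ≤ 3/10} ∩ {‖x‖² ≥ 7/2}`. [folklore] -/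
theorem strGain_eq_one {q : EuclideanSpace ℝ (Fin 4)} (hρ : rho g q ≤ 3 / 10) (hx : 7 / 2 ≤ ‖cx q‖ ^ 2) :
    strGain g q = 1 := by
  rw [strGain, cutA_of_le hρ, cutB_of_ge hx, one_mul]

/-- The gain vanishes on `{rho ≥ 2/5}`. [folklore] -/
theorem strGain_eq_zero_of_le {q : EuclideanSpace ℝ (Fin 4)} (h : 2 / 5 ≤ rho g q) : strGain g q = 0 := by
  rw [strGain, cutA_of_ge h, zero_mul]

/-- The gain vanishes on `{‖x‖² ≤ 3}`. [folklore] -/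
theorem strGain_eq_zero_of_cx_le {q : EuclideanSpace ℝ (Fin 4)} (h : ‖cx q‖ ^ 2 ≤ 3) :
    strGain g q = 0 := by
  rw [strGain, cutB_of_le h, mul_zero]

/-- Where the gain does not vanish, `rho < 1/2` and `‖x‖² ≥ 3`, hence `y ≠ 0`. [folklore] -/
theorem cy_ne_zero_of_strGain_ne_zero {q : EuclideanSpace ℝ (Fin 4)} (h : strGain g q ≠ 0) :
    cy q ≠ 0 := by
  have hρ : rho g q < 1 / 2 := by
    by_contra hc
    exact h (strGain_eq_zero_of_le (by linarith [not_lt.1 hc]))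
  have hx : 3 ≤ ‖cx q‖ ^ 2 := by
    by_contra hc
    exact h (strGain_eq_zero_of_cx_le (not_le.1 hc).le)
  exact cy_ne_zero_of_rho_lt_half hρ hx

/-! ## §2 Algebra: `dx`, `dw` and `d rho` of the fields -/

/-- `dx` of the core field: `−‖w‖² x`. [folklore] -/
@[simp] theorem cx_strCore (q : EuclideanSpace ℝ (Fin 4)) :
    cx (strCore g q) = -(((‖w g q‖ ^ 2 : ℝ) : ℂ) * cx q) := cx_mk _ _

/-- `dΦ` of the core field is `strMu · w` where `y ≠ 0`. [folklore] -/
theorem dPhi_strCore {q : EuclideanSpace ℝ (Fin 4)} (hy : cy q ≠ 0) :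
    dPhiX g q * cx (strCore g q) + dPhiY q * cy (strCore g q) = ((strMu q : ℝ) : ℂ) * w g q := by
  have hb : dPhiY q ≠ 0 := by unfold dPhiY; exact mul_ne_zero two_ne_zero hy
  simp only [strCore, cx_mk, cy_mk]
  rw [mul_div_cancel₀ _ hb]
  ring

/-- The core field vanishes on the binding `w = 0`. [folklore] -/
theorem strCore_eq_zero_of_w_eq_zero {q : EuclideanSpace ℝ (Fin 4)} (h : w g q = 0) : strCore g q = 0 := by
  have e : strCore g q = mk 0 0 := by
    simp only [strCore, h, norm_zero, mul_zero]
    norm_num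
  rw [e]
  ext i
  fin_cases i <;> simp [mk]

/-- **`dx` of the straightening field**: `−(L · strGain · ‖w‖²) · x`. [folklore] -/
theorem cx_strField (q : EuclideanSpace ℝ (Fin 4)) :
    cx (strField g L q) = -(((L * strGain g q * ‖w g q‖ ^ 2 : ℝ) : ℂ) * cx q) := by
  rw [strField, cx_smul, cx_strCore]
  push_cast
  ring

/-- The straightening field vanishes where the gain does. [folklore] -/
theorem strField_eq_zero_of_strGain_eq_zero {q : EuclideanSpace ℝ (Fin 4)} (h : strGain g q = 0) :
    strField g L q = 0 := by
  rw [strField, h, mul_zero, zero_smul]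

/-- The straightening field vanishes on `{rho ≥ 2/5}`. [folklore] -/
theorem strField_eq_zero_of_le {q : EuclideanSpace ℝ (Fin 4)} (h : 2 / 5 ≤ rho g q) :
    strField g L q = 0 :=
  strField_eq_zero_of_strGain_eq_zero (strGain_eq_zero_of_le h)

/-- The straightening field vanishes on `{‖x‖² ≤ 3}` (deep inside the flat part). [folklore] -/
theorem strField_eq_zero_of_cx_le {q : EuclideanSpace ℝ (Fin 4)} (h : ‖cx q‖ ^ 2 ≤ 3) :
    strField g L q = 0 :=
  strField_eq_zero_of_strGain_eq_zero (strGain_eq_zero_of_cx_le h)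

/-- The straightening field vanishes on the binding `w = 0`. [folklore] -/
theorem strField_eq_zero_of_w_eq_zero {q : EuclideanSpace ℝ (Fin 4)} (h : w g q = 0) :
    strField g L q = 0 := by
  rw [strField, strCore_eq_zero_of_w_eq_zero h, smul_zero]

/-- The straightening field vanishes off the compact set `{rho g ≤ 2/5}`. [folklore] -/
theorem strField_eq_zero_of_not_mem {q : EuclideanSpace ℝ (Fin 4)}
    (hq : q ∉ (rho g ⁻¹' Iic (2 / 5) : Set (EuclideanSpace ℝ (Fin 4)))) : strField g L q = 0 :=
  strField_eq_zero_of_le (le_of_lt (not_le.1 hq))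

/-- **`dw` of the straightening field is the REAL multiple `(L · strGain · strMu) · w` of `w`.**
[folklore] -/
theorem fderiv_w_strField (q : EuclideanSpace ℝ (Fin 4)) :
    fderiv ℝ (w g) q (strField g L q) = ((L * strGain g q * strMu q : ℝ) : ℂ) * w g q := by
  by_cases h0 : strGain g q = 0
  · rw [strField_eq_zero_of_strGain_eq_zero h0, map_zero, h0, mul_zero, zero_mul]
    simp
  · rw [strField, (fderiv ℝ (w g) q).map_smul, fderiv_w_apply,
      dPhi_strCore (cy_ne_zero_of_strGain_ne_zero h0), Complex.real_smul]
    push_cast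
    ring

/-- **The straightening field is tangent to the levels of `rho`**: `d rho(V) = 0`
(`2 Re(w̄ · μ w) = 2 μ ‖w‖²` cancels `eta' · 2 Re(x̄ · (−‖w‖² x)) = −2 eta' ‖w‖² ‖x‖²`).
[folklore] -/
theorem fderiv_rho_strField (q : EuclideanSpace ℝ (Fin 4)) :
    fderiv ℝ (rho g) q (strField g L q) = 0 := by
  rw [fderiv_rho_apply, fderiv_w_strField, cx_strField]
  have h1 : (conj (w g q) * (((L * strGain g q * strMu q : ℝ) : ℂ) * w g q)).re =
      L * strGain g q * strMu q * ‖w g q‖ ^ 2 := by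
    have e : conj (w g q) * (((L * strGain g q * strMu q : ℝ) : ℂ) * w g q) =
        ((L * strGain g q * strMu q * ‖w g q‖ ^ 2 : ℝ) : ℂ) := by
      push_cast
      rw [← Complex.conj_mul']
      ring
    rw [e, Complex.ofReal_re]
  have h2 : (conj (cx q) * -(((L * strGain g q * ‖w g q‖ ^ 2 : ℝ) : ℂ) * cx q)).re =
      -(L * strGain g q * ‖w g q‖ ^ 2 * ‖cx q‖ ^ 2) := by
    have e : conj (cx q) * -(((L * strGain g q * ‖w g q‖ ^ 2 : ℝ) : ℂ) * cx q) =
        -(((L * strGain g q * ‖w g q‖ ^ 2 : ℝ) : ℂ) * (conj (cx q) * cx q)) := by ring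
    rw [e, Complex.neg_re, Complex.re_ofReal_mul, re_conj_mul_self]
  rw [h1, h2, strMu]
  ring

/-! ## §3 Smoothness -/

/-- `eta'` is smooth. [folklore] -/
theorem contDiff_deriv_eta : ContDiff ℝ ∞ (deriv eta) := (contDiff_infty_iff_deriv.1 contDiff_eta).2

/-- `strMu` is smooth. [folklore] -/
theorem contDiff_strMu : ContDiff ℝ ∞ strMu :=
  (contDiff_deriv_eta.comp (contDiff_norm_sq_complex.comp contDiff_cx)).mul
    (contDiff_norm_sq_complex.comp contDiff_cx)

/-- The gain is smooth. [folklore] -/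
theorem contDiff_strGain : ContDiff ℝ ∞ (strGain g) :=
  (contDiff_cutA.comp (contDiff_rho g)).mul contDiff_cutB_cx

/-- The core field is smooth where `y ≠ 0`. [folklore] -/
theorem contDiffAt_strCore {q : EuclideanSpace ℝ (Fin 4)} (hy : cy q ≠ 0) :
    ContDiffAt ℝ ∞ (strCore g) q := by
  have hb : dPhiY q ≠ 0 := by unfold dPhiY; exact mul_ne_zero two_ne_zero hy
  have hw2 : ContDiff ℝ ∞ fun p : EuclideanSpace ℝ (Fin 4) => (((‖w g p‖ ^ 2 : ℝ) : ℂ) * cx p) :=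
    (Complex.ofRealCLM.contDiff.comp (contDiff_norm_sq_complex.comp (contDiff_w g))).mul contDiff_cx
  have h1 : ContDiff ℝ ∞ fun p : EuclideanSpace ℝ (Fin 4) => -(((‖w g p‖ ^ 2 : ℝ) : ℂ) * cx p) :=
    hw2.neg
  have hnum : ContDiff ℝ ∞ fun p : EuclideanSpace ℝ (Fin 4) =>
      ((strMu p : ℝ) : ℂ) * w g p + dPhiX g p * (((‖w g p‖ ^ 2 : ℝ) : ℂ) * cx p) :=
    ((Complex.ofRealCLM.contDiff.comp contDiff_strMu).mul (contDiff_w g)).add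
      ((contDiff_dPhiX g).mul hw2)
  have h2 : ContDiffAt ℝ ∞ (fun p : EuclideanSpace ℝ (Fin 4) =>
      (((strMu p : ℝ) : ℂ) * w g p + dPhiX g p * (((‖w g p‖ ^ 2 : ℝ) : ℂ) * cx p)) / dPhiY p) q := by
    simp only [div_eq_mul_inv]
    exact hnum.contDiffAt.mul (contDiff_dPhiY.contDiffAt.inv hb)
  exact ContDiffAt.mk₂ h1.contDiffAt h2

/-- **The straightening field is smooth on all of `ℝ⁴`** (where `y = 0` the gain vanishes
identically nearby: either `‖x‖² < 3` or `rho > 2/5`). [folklore] -/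
theorem contDiff_strField (g : ℕ) (L : ℝ) : ContDiff ℝ ∞ (strField g L) := by
  refine contDiff_iff_contDiffAt.2 fun q => ?_
  by_cases hy : cy q ≠ 0
  · exact (contDiff_const.mul contDiff_strGain).contDiffAt.smul (contDiffAt_strCore hy)
  · rw [not_not] at hy
    by_cases hρ : rho g q < 1 / 2
    · have hx : ‖cx q‖ ^ 2 < 3 := by
        by_contra hc
        exact cy_ne_zero_of_rho_lt_half hρ (not_lt.1 hc) hy
      have hU : IsOpen {p : EuclideanSpace ℝ (Fin 4) | ‖cx p‖ ^ 2 < 3} :=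
        isOpen_lt (contDiff_norm_sq_complex.comp contDiff_cx).continuous continuous_const
      refine (contDiffAt_const (c := (0 : EuclideanSpace ℝ (Fin 4)))).congr_of_eventuallyEq ?_
      filter_upwards [hU.mem_nhds hx] with p hp
      exact strField_eq_zero_of_cx_le (le_of_lt hp)
    · have hU : IsOpen {p : EuclideanSpace ℝ (Fin 4) | 2 / 5 < rho g p} :=
        isOpen_lt continuous_const (contDiff_rho g).continuous
      refine (contDiffAt_const (c := (0 : EuclideanSpace ℝ (Fin 4)))).congr_of_eventuallyEq ?_
      filter_upwards [hU.mem_nhds (show 2 / 5 < rho g q by linarith [not_lt.1 hρ])] with p hp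
      exact strField_eq_zero_of_le (le_of_lt hp)

/-! ## §4 The registered sub-goal -/

/-- **(ST2, field part) The radial straightening field of the Lefschetz base** (registered
sub-goal `helper_strField_spec` of NF6, node T3c-2): for every speed `L` there is a smooth vector
field `V` on `ℝ⁴ = ℂ² ⊃ Base g` (namely `strField g L`), vanishing off the compact neighbourhood
`{rho g ≤ 2/5}` of the base, on `{‖x‖² ≤ 3}` and on the binding `{w = 0}`, tangent to every level
of `rho g` (its flow preserves the base and its boundary), with `dw(V)` a NON-NEGATIVE REAL
multiple of `w` (its flow preserves every extended page `{w ∈ ℝ_{>0} c}` and does not decrease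
`‖w‖`) and `dx(V) = −κ · x` with `0 ≤ κ ≤ L ‖w‖²` everywhere and `κ = L ‖w‖²` on
`{rho ≤ 3/10} ∩ {‖x‖² ≥ 7/2}` (its flow pushes the bent part of every extended page into the flat
page at a rate bounded below) — the infinitesimal generator of the fibred "radial straightening"
isotopy of `∂ Base g` used to read seam-transported page curves in flat pages.
[cite: Baykur2006, Thm. 5.1 (proof, p. 13)] -/
theorem helper_strField_spec : ∀ (g : ℕ) (L : ℝ), 0 ≤ L → ∃ V : EuclideanSpace ℝ (Fin 4) → EuclideanSpace ℝ (Fin 4), ContDiff ℝ ∞ V ∧ IsCompact (Literature.Topology.FourManifolds.LefschetzBase.rho g ⁻¹' Set.Iic (2 / 5)) ∧ (∀ q, q ∉ Literature.Topology.FourManifolds.LefschetzBase.rho g ⁻¹' Set.Iic (2 / 5) → V q = 0) ∧ (∀ q, Literature.Topology.FourManifolds.LefschetzBase.w g q = 0 → V q = 0) ∧ (∀ q, ‖Literature.Topology.FourManifolds.LefschetzBase.cx q‖ ^ 2 ≤ 3 → V q = 0) ∧ (∀ q, fderiv ℝ (Literature.Topology.FourManifolds.LefschetzBase.rho g) q (V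 q) = 0) ∧ (∀ q, ∃ ν : ℝ, 0 ≤ ν ∧ fderiv ℝ (Literature.Topology.FourManifolds.LefschetzBase.w g) q (V q) = (ν : ℂ) * Literature.Topology.FourManifolds.LefschetzBase.w g q) ∧ (∀ q, ∃ κ : ℝ, 0 ≤ κ ∧ κ ≤ L * ‖Literature.Topology.FourManifolds.LefschetzBase.w g q‖ ^ 2 ∧ Literature.Topology.FourManifolds.LefschetzBase.cx (V q) = -((κ : ℂ) * Literature.Topology.FourManifolds.LefschetzBase.cx q) ∧ (Literature.Topology.FourManifolds.LefschetzBase.rho g q ≤ 3 / 10 → 7 / 2 ≤ ‖Literature.Topology.FourManifolds.LefschetzBase.cx q‖ ^ 2 → κ = L * ‖Literature.Topology.FourManifolds.LefschetzBase.w g q‖ ^ 2)) := by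
  intro g L hL
  refine ⟨strField g L, contDiff_strField g L, isCompact_rho_le_two_fifths g,
    fun q hq => strField_eq_zero_of_not_mem hq, fun q hq => strField_eq_zero_of_w_eq_zero hq,
    fun q hq => strField_eq_zero_of_cx_le hq, fderiv_rho_strField, fun q => ?_, fun q => ?_⟩
  · refine ⟨L * strGain g q * strMu q, ?_, fderiv_w_strField q⟩
    exact mul_nonneg (mul_nonneg hL (strGain_nonneg q)) (strMu_nonneg q)
  · refine ⟨L * strGain g q * ‖w g q‖ ^ 2, ?_, ?_, ?_, fun hρ hx => ?_⟩
    · exact mul_nonneg (mul_nonneg hL (strGain_nonneg q)) (sq_nonneg _)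
    · have h := strGain_le_one (g := g) q
      have h0 := strGain_nonneg (g := g) q
      nlinarith [sq_nonneg ‖w g q‖, mul_nonneg hL (sq_nonneg ‖w g q‖)]
    · rw [cx_strField]
    · rw [strGain_eq_one hρ hx, mul_one]

end Summit.SmoothPoincare4.SmoothPoincare4.Theorems.AcyclicBisectionExists.ModpBraidOrbits

end
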